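import Mathlib
import Literature.MathematicalPhysics.QuantumFieldTheory.Balaban1983to89.Beta.DeltaACombesThomas
import Summits.QuantumFields.BalabanUV.T4Continuum.Support.SliceFlatStencil

/-!
# T⁴ programme, node NE3 (η-rate of the minimisers) — THE FLAT RUNG, part 4: the MASS-DEVIATION TERM of the flat
# remainder form obeys the (3.49)-type entry bound with LEVEL-FREE constants (size `≤ 2(L^j)^{−(d+3)}`, range one block)

Fourteenth generation of the NE3 prover lineage P1 of the cell `pub-balaban`, file 1.  Part 3 (`SliceFlatStencil`,
p199400) decomposed the remainder form of the flat family EXACTLY: `flatNg j = −η_j²·RI j Re(∂P_j∂*) + (η_j²·RI j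
Re(Q*_jQ_j) − massKernel (cubeI j) τ_j (1/(L^j)^{d+3}))` — Bałaban's (negative) gauge part of [B5] (1.69)–(1.70) plus the
deviation of the LINE-averaged mass term `a·Q*Q` of (1.8)∕(1.18) from the block-diagonal mass model of the skeleton.
THIS FILE proves the (3.49)-type entry bound for the second summand (the «mass deviation» `massDev j`):
 * §1 (pv15∕β carrier, generic `n`, `M`, dimension `D`) — from the β-cell's `Beta.DeltaACombesThomas` §4 (`qr`, row sums
   `1`, column sums `n^{−D}` of `|Q_k|`, [B5] (1.6)∕(1.18)): **`norm_QvAdj_QvOp_le`** `‖(Q*_kQ_k)(i,i′)‖ ≤ n^{−D}` for ALL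
   entries (the factor `n^D` of `Q*_k` against one column sum and one sup), and **`exists_stencil_of_ne_zero`**: a
   non-zero entry `(i, i′)` has both indices on ONE extended block stencil `{(n·y + r + t·e_μ, μ)}` of a coarse bond
   `(y, μ)`;
 * §2 (NE3 carrier) — **`cube_of_eF_eq_stencil`**: a fine site whose reindexing is the stencil point `n·y + r + t·e_μ`
   (`0 ≤ r_ν, t < n`) lies in the level-`j` cube `y + c·e_μ` with `c = ⌊(r_μ + t)/n⌋ ∈ {0, 1}` (integer arithmetic in
   `ZMod`, wrap-around included), hence **`nbd_le_one_of_stencil`**: two sites on one stencil have cubes at integer ℓ¹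
   block distance `≤ 1`;
 * §3 — `massDev j := η_j²·RI j Re(Q*_jQ_j) − massKernel (cubeI j) τ_j (1/(L^j)^{d+3})`, `gaugeDev j := η_j²·RI j
   Re(∂P_j∂*)`, **`flatNg_eq_neg_gaugeDev_add_massDev`** (part 3's identity, renamed), **`abs_massDev_le`**
   (`|massDev j (z,w)| ≤ (L^{min(j,k)})^{−(d+3)} + (L^j)^{−(d+3)}` at every level; `|τ| ≤ 1` by `abs_tau_le_one`, the mass
   model is block-diagonal), **`nbd_le_one_of_massDev_ne_zero`** (range: cubes at block distance `≤ 1`), and the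
   deliverable **`abs_massDev_le_349`**: for `j ≤ k` and every `δ ≥ 0`,
   `|massDev j (z,w)| ≤ (2e^{δ/2}) · pref4inv(L^j)₃ · (L^j)^{−(d+1)} · e^{−(δ/2)·nbd_j(cube z, cube w)}`
   — EXACTLY the entry-bound shape of `SliceTorusBlockModel.ineq349_fineKernelOf_of_entryBounds` ∕
   `SliceTorusTower.stmt349Printed_torus_of_entryBounds` at the item `n = 3` (`DPD*`, the slot of the gauge∕remainder
   form `Fk 3 = Ng` in the one type `SliceCovariantLevels.ne3Shape_torusCovE_upto_of_printedStatements`, binder `hF3`),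
   with constants depending on NOTHING (uniform in `j ≤ k`, `k`, `N`, `L`, `d`).
WHAT THIS BUYS (honest, and nothing more): of the stability reading `hT349` ((3.49) for the remainder form) of the
lineage's one type, AT `U = 1` the MASS-DEVIATION half is a theorem with level-free constants; the GAUGE half
(`gaugeDev j = η_j²·Re(∂P_j∂*)`, (1.126)-type decay uniformly in `n = L^j`) is NOT attempted here — it needs the bridge
between pv15's `B5Value126.PcT` ((1.70), Sect. C form on `Tor (fine n M)`) and the b05∕pv15 kernel chain
`B5DPD126Uniform`∕`B5DPD126Gradient` ((1.44) form `G′Q′*(Q′G′²Q′*)⁻¹Q′G′` on `UT (n·N)`), which is not in the tree.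
NE3 is NOT proved.

Honest framing: finite-T⁴ ultraviolet bookkeeping about MINIMISERS (rung (B)+1 of the cell's ladder); no conditional of
the cell (`BetaPertH`, (B), (B^μ)) is used or hidden; nothing bears on infinite volume, a mass gap, or the Clay problem.
ABSOLUTE RULE of the cell kept: inputs are kernel-proved tree modules only (β-cell `Beta.DeltaACombesThomas` §4, pv15's
`B5Blocks16`∕`B5Block118`, the lineage's flat-rung files).  No `sorry`, no axioms beyond Mathlib's.  PLACEMENT (human
rule 2026-08-19): cell work under `Summits/QuantumFields/BalabanUV/`; imports `Support.SliceFlatStencil` (p199400) and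
`Literature.….Beta.DeltaACombesThomas`; moves nothing.  Records: `t4/T4-EST-U1b-OSC.md` v1.28 (RESULT 36),
`t4/T4-EST-NE3-P1.md` v2.27, GAPS G-ne3p1-42 of the cell `pub-balaban`.
-/

noncomputable section

open Finset Real Matrix

namespace Summit.QuantumFields.BalabanUV.T4Continuum.SliceFlatMassTerm

open Literature.MathematicalPhysics.QuantumFieldTheory.Balaban1983to89
open Literature.MathematicalPhysics.QuantumFieldTheory.Balaban1983to89.TreeLengthTorus (TPt)
open Literature.MathematicalPhysics.QuantumFieldTheory.Balaban1983to89.B5Prop11Plancherel (Tor fine unitVec)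
open Literature.MathematicalPhysics.QuantumFieldTheory.Balaban1983to89.B5Action121 (GradOp)
open Literature.MathematicalPhysics.QuantumFieldTheory.Balaban1983to89.B5Value126 (PcT)
open Literature.MathematicalPhysics.QuantumFieldTheory.Balaban1983to89.B5Block118 (QvOp bpt tstep)
open Literature.MathematicalPhysics.QuantumFieldTheory.Balaban1983to89.B5Blocks16 (bpt_val)
open Literature.MathematicalPhysics.QuantumFieldTheory.Balaban1983to89.B5DeltaA169 (QvAdj)
open Literature.MathematicalPhysics.QuantumFieldTheory.Balaban1983to89.B5RealFields (reM)
open Literature.MathematicalPhysics.QuantumFieldTheory.Balaban1983to89.Beta.DeltaACombesThomas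
  (qr qr_nonneg qr_ne_zero sum_qr_col norm_QvOpH_QvOp_le)
open Literature.MathematicalPhysics.QuantumFieldTheory.Balaban1983to89.T4SliceOperatorData (massKernel abs_massKernel_le)
open Summit.QuantumFields.BalabanUV.T4Continuum.SliceTorusBlocks
open Summit.QuantumFields.BalabanUV.T4Continuum.SliceTorusTower
open Summit.QuantumFields.BalabanUV.T4Continuum.SliceCovariantModel
open Summit.QuantumFields.BalabanUV.T4Continuum.SliceCovariantTower
open Summit.QuantumFields.BalabanUV.T4Continuum.SliceTorusComb
open Summit.QuantumFields.BalabanUV.T4Continuum.SliceFlatPropagator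
open Summit.QuantumFields.BalabanUV.T4Continuum.SliceFlatOperators
open Summit.QuantumFields.BalabanUV.T4Continuum.SliceFlatStencil

/-! ## §1  Entries and support of `Q*_kQ_k` on Bałaban's fine torus (generic dimension `D`, `n = η⁻¹`, multi-period `M`) -/
section QQ

variable {D : ℕ} (n : ℕ) [NeZero n] (M : Fin D → ℕ) [∀ μ, NeZero (M μ)]

/-- A single entry of `|Q_k|` is at most the column sum `n^{−D}`. [folklore] -/
theorem qr_le (b : Tor M × Fin D) (i : Tor (fine n M) × Fin D) : qr n M b i ≤ 1 / (n : ℝ) ^ D := by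
  rw [← sum_qr_col n M i]
  exact Finset.single_le_sum (f := fun b' => qr n M b' i) (fun b' _ => qr_nonneg n M b' i) (Finset.mem_univ b)

omit [NeZero n] in
/-- The entries of `Q*_kQ_k` against the modulus kernel: `‖(Q*_kQ_k)(i,i′)‖ ≤ n^D Σ_b qr(b,i) qr(b,i′)`. [folklore] -/
theorem norm_QvAdj_QvOp_le_sum (i i' : Tor (fine n M) × Fin D) :
    ‖(QvAdj n M * QvOp n M) i i'‖ ≤ (n : ℝ) ^ D * ∑ b, qr n M b i * qr n M b i' := by
  have hnd : (0 : ℝ) ≤ (n : ℝ) ^ D := by positivity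
  rw [QvAdj, Matrix.smul_mul, Matrix.smul_apply, smul_eq_mul, norm_mul, norm_pow, Complex.norm_natCast]
  exact mul_le_mul_of_nonneg_left (norm_QvOpH_QvOp_le n M i i') hnd

/-- **ALL ENTRIES OF `Q*_kQ_k` ARE AT MOST `n^{−D}`** (`Q*_k = n^D Q_kᴴ` of [B5] (1.69); one column sum `n^{−D}` of
`|Q_k|` and one entry bound `n^{−D}`). [folklore] -/
theorem norm_QvAdj_QvOp_le (i i' : Tor (fine n M) × Fin D) :
    ‖(QvAdj n M * QvOp n M) i i'‖ ≤ 1 / (n : ℝ) ^ D := by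
  have hn : (n : ℝ) ≠ 0 := by exact_mod_cast NeZero.ne n
  have hnd : (0 : ℝ) < (n : ℝ) ^ D := by positivity
  have h3 : ∑ b, qr n M b i * qr n M b i' ≤ (1 / (n : ℝ) ^ D) * (1 / (n : ℝ) ^ D) := by
    calc ∑ b, qr n M b i * qr n M b i' ≤ ∑ b, qr n M b i * (1 / (n : ℝ) ^ D) :=
          Finset.sum_le_sum fun b _ => mul_le_mul_of_nonneg_left (qr_le n M b i') (qr_nonneg n M b i)
      _ = (∑ b, qr n M b i) * (1 / (n : ℝ) ^ D) := by rw [Finset.sum_mul]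
      _ = (1 / (n : ℝ) ^ D) * (1 / (n : ℝ) ^ D) := by rw [sum_qr_col]
  calc ‖(QvAdj n M * QvOp n M) i i'‖ ≤ (n : ℝ) ^ D * ∑ b, qr n M b i * qr n M b i' :=
        norm_QvAdj_QvOp_le_sum n M i i'
    _ ≤ (n : ℝ) ^ D * ((1 / (n : ℝ) ^ D) * (1 / (n : ℝ) ^ D)) := mul_le_mul_of_nonneg_left h3 hnd.le
    _ = 1 / (n : ℝ) ^ D := by field_simp

omit [NeZero n] in
/-- A non-zero entry of `Q*_kQ_k` has a coarse bond `b` on whose extended stencil both indices lie. [folklore] -/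
theorem exists_qr_ne_zero (i i' : Tor (fine n M) × Fin D) (h : (QvAdj n M * QvOp n M) i i' ≠ 0) :
    ∃ b : Tor M × Fin D, qr n M b i ≠ 0 ∧ qr n M b i' ≠ 0 := by
  by_contra hne
  simp only [not_exists, not_and_or, Ne, not_not] at hne
  apply h
  have hsum : ∑ b, qr n M b i * qr n M b i' = 0 :=
    Finset.sum_eq_zero fun b _ => by rcases hne b with h0 | h0 <;> simp [h0]
  have h1 := norm_QvAdj_QvOp_le_sum n M i i'
  rw [hsum, mul_zero] at h1
  exact norm_le_zero_iff.mp h1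

omit [NeZero n] in
/-- **SUPPORT OF `Q*_kQ_k`**: a non-zero entry `(i, i′)` lies on ONE extended block stencil — `i = (n·y + r + t·e_μ, μ)`,
`i′ = (n·y + r′ + t′·e_μ, μ)` for a coarse bond `(y, μ)` ([B5] (1.18): `Q_k` averages over the straight contours
`[x, x + e_μ]`, `x ∈ B^k(y)`). [folklore] -/
theorem exists_stencil_of_ne_zero (i i' : Tor (fine n M) × Fin D) (h : (QvAdj n M * QvOp n M) i i' ≠ 0) :
    ∃ (b : Tor M × Fin D) (r : Fin D → Fin n) (t : Fin n) (r' : Fin D → Fin n) (t' : Fin n),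
      i = (bpt n M b.1 r + tstep (fine n M) b.2 t, b.2) ∧ i' = (bpt n M b.1 r' + tstep (fine n M) b.2 t', b.2) := by
  obtain ⟨b, hb, hb'⟩ := exists_qr_ne_zero n M i i' h
  obtain ⟨r, t, hr⟩ := qr_ne_zero n M b i hb
  obtain ⟨r', t', hr'⟩ := qr_ne_zero n M b i' hb'
  exact ⟨b, r, t, r', t', hr, hr'⟩

end QQ

/-! ## §2  Where the stencil points lie: cubes at block distance `≤ 1` -/
section Stencil

variable (d k N L : ℕ) [NeZero N] [NeZero L]

/-- The integer periodic ℓ¹ length of `(c₁ − c₂)·e_μ` with `c₁, c₂ ∈ {0, 1}` is at most `1`. [folklore] -/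
theorem npl1_single_sub_le_one {T : ℕ} [NeZero T] (μ : Fin (d + 1)) {c₁ c₂ : ℕ} (h₁ : c₁ ≤ 1) (h₂ : c₂ ≤ 1) :
    npl1 (Pi.single μ ((c₁ : ZMod T) - (c₂ : ZMod T)) : TPt (d + 1) T) ≤ 1 := by
  unfold npl1
  rw [Finset.sum_eq_single μ (fun i _ hi => by rw [Pi.single_eq_of_ne hi, ZMod.valMinAbs_zero, Int.natAbs_zero])
    (fun h => absurd (Finset.mem_univ μ) h), Pi.single_eq_same]
  have hone : ((1 : ZMod T)).valMinAbs.natAbs ≤ 1 := by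
    rw [ZMod.valMinAbs_natAbs_eq_min, ZMod.val_one_eq_one_mod]
    exact (min_le_left _ _).trans (Nat.mod_le 1 T)
  interval_cases c₁ <;> interval_cases c₂
  · simp
  · rw [Nat.cast_zero, Nat.cast_one, zero_sub, ZMod.natAbs_valMinAbs_neg]; exact hone
  · rw [Nat.cast_zero, Nat.cast_one, sub_zero]; exact hone
  · simp

/-- **CUBE OF A STENCIL POINT**: if the level-`j` reindexing of the fine site `z` is Bałaban's `n·y + r + t·e_μ`
(`n = L^{min(j,k)}`, `0 ≤ r_ν < n`, `0 ≤ t < n`), then `cube j z = y + c·e_μ` with `c = ⌊(r_μ + t)/n⌋ ≤ 1` (the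
straight contour `[x, x + e_μ]` from a point of `B^j(y)` stays in `B^j(y) ∪ B^j(y + e_μ)`; wrap-around included). [folklore] -/
theorem cube_of_eF_eq_stencil (j : ℕ) (z : TPt (d + 1) (N * L ^ k)) (y : TPt (d + 1) (levM k N L j))
    (r : Fin (d + 1) → Fin (side k L j)) (μ : Fin (d + 1)) (t : Fin (side k L j))
    (h : eF d k N L j z = bpt (side k L j) (Mlev d k N L j) y r + tstep (fine (side k L j) (Mlev d k N L j)) μ t) :
    cube (d + 1) k N L j z = y + Pi.single μ ((((r μ : ℕ) + t) / side k L j : ℕ) : ZMod (levM k N L j))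
      ∧ ((r μ : ℕ) + t) / side k L j ≤ 1 := by
  have hn0 : 0 < side k L j := one_le_side k L j
  have hc : ((r μ : ℕ) + t) / side k L j ≤ 1 := by
    have h2 : ((r μ : ℕ) + t) / side k L j < 2 := by
      rw [Nat.div_lt_iff_lt_mul hn0]
      have := (r μ).isLt; have := t.isLt; omega
    omega
  refine ⟨funext fun ν => ?_, hc⟩
  -- the value of the `ν`-th coordinate of `z`
  have hval : (z ν).val
      = ((bpt (side k L j) (Mlev d k N L j) y r + tstep (fine (side k L j) (Mlev d k N L j)) μ t) ν).val := by
    rw [← val_eF d k N L j z ν, h]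
  show blockOf (levM k N L j) (side k L j) (z ν)
    = (y + Pi.single μ ((((r μ : ℕ) + t) / side k L j : ℕ) : ZMod (levM k N L j)) : TPt (d + 1) (levM k N L j)) ν
  unfold SliceTorusBlocks.blockOf
  rw [hval, Pi.add_apply, Pi.add_apply]
  by_cases hν : ν = μ
  · subst hν
    rw [Pi.single_eq_same]
    have ht : tstep (fine (side k L j) (Mlev d k N L j)) ν (t : ℕ) ν
        = ((t : ℕ) : ZMod (fine (side k L j) (Mlev d k N L j) ν)) := by
      simp [tstep]
    rw [ht, ZMod.val_add, bpt_val, ZMod.val_natCast]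
    have htlt : (t : ℕ) % fine (side k L j) (Mlev d k N L j) ν = t := by
      apply Nat.mod_eq_of_lt
      show (t : ℕ) < side k L j * levM k N L j
      have h1 : 1 ≤ levM k N L j := Nat.one_le_iff_ne_zero.2 (NeZero.ne _)
      calc (t : ℕ) < side k L j := t.isLt
        _ = side k L j * 1 := (mul_one _).symm
        _ ≤ side k L j * levM k N L j := Nat.mul_le_mul_left _ h1
    rw [htlt]
    show ((((side k L j * (y ν).val + (r ν : ℕ) + t) % (side k L j * levM k N L j)) / side k L j : ℕ)
        : ZMod (levM k N L j)) = _
    rw [Nat.mod_mul_right_div_self, add_assoc, Nat.mul_add_div hn0, ZMod.natCast_mod, Nat.cast_add,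
      ZMod.natCast_zmod_val]
  · rw [Pi.single_eq_of_ne hν, add_zero]
    have ht : tstep (fine (side k L j) (Mlev d k N L j)) μ (t : ℕ) ν = 0 := by
      simp [tstep, hν]
    rw [ht, add_zero, bpt_val, Nat.mul_add_div hn0, Nat.div_eq_of_lt (r ν).isLt, add_zero, ZMod.natCast_zmod_val]

/-- **TWO SITES ON ONE STENCIL HAVE CUBES AT BLOCK DISTANCE `≤ 1`.** [folklore] -/
theorem nbd_le_one_of_stencil (j : ℕ) (z w : TPt (d + 1) (N * L ^ k)) (y : TPt (d + 1) (levM k N L j))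
    (μ : Fin (d + 1)) (r r' : Fin (d + 1) → Fin (side k L j)) (t t' : Fin (side k L j))
    (hz : eF d k N L j z = bpt (side k L j) (Mlev d k N L j) y r + tstep (fine (side k L j) (Mlev d k N L j)) μ t)
    (hw : eF d k N L j w = bpt (side k L j) (Mlev d k N L j) y r' + tstep (fine (side k L j) (Mlev d k N L j)) μ t') :
    nbd (d + 1) k N L j (cube (d + 1) k N L j z) (cube (d + 1) k N L j w) ≤ 1 := by
  obtain ⟨hcz, hc1⟩ := cube_of_eF_eq_stencil d k N L j z y r μ t hz
  obtain ⟨hcw, hc2⟩ := cube_of_eF_eq_stencil d k N L j w y r' μ t' hw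
  unfold nbd
  rw [hcz, hcw, add_sub_add_left_eq_sub, ← Pi.single_sub]
  exact npl1_single_sub_le_one d μ hc1 hc2

end Stencil

/-! ## §3  The mass-deviation term of the flat remainder form: size `≤ 2(L^j)^{−(d+3)}`, range one block, (3.49) shape -/
section MassDev

variable (d k N L : ℕ) [NeZero N] [NeZero L]

/-- **THE GAUGE PART** of the flat level operator (up to sign): `η_j² · Re(∂P_j∂*)` of [B5] (1.69)–(1.70) reindexed to the
NE3 carrier (pv15's `GradOp · PcT · GradOpᴴ` at `c = n`). [model] -/
def gaugeDev (j : ℕ) : Matrix (TPt (d + 1) (N * L ^ k) × Fin (d + 1)) (TPt (d + 1) (N * L ^ k) × Fin (d + 1)) ℝ :=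
  ((side k L j : ℝ) ^ 2)⁻¹ • RI d k N L j
    (reM (GradOp (fine (side k L j) (Mlev d k N L j)) (side k L j : ℂ) * PcT (side k L j) (Mlev d k N L j) (side k L j : ℂ)
      * (GradOp (fine (side k L j) (Mlev d k N L j)) (side k L j : ℂ))ᴴ))

/-- **THE MASS-DEVIATION TERM** of the flat remainder form: the line-averaged mass term `η_j²·Re(Q*_jQ_j)` of [B5]
(1.8)∕(1.18)∕(1.69) reindexed, minus the block-diagonal mass model `massKernel (cubeI j) τ_j (1/(L^j)^{d+3})` of the
skeleton. [model] -/
def massDev (j : ℕ) : Matrix (TPt (d + 1) (N * L ^ k) × Fin (d + 1)) (TPt (d + 1) (N * L ^ k) × Fin (d + 1)) ℝ :=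
  ((side k L j : ℝ) ^ 2)⁻¹ • RI d k N L j (reM (QvAdj (side k L j) (Mlev d k N L j) * QvOp (side k L j) (Mlev d k N L j)))
    - massKernel (cubeI (d + 1) k N L (Fin (d + 1)) j) (tau (cubeComb (d + 1) k N L j) (flatRm d k N L))
        (flatAm j / ((L : ℝ) ^ j) ^ (d + 1 + 2))

/-- Part 3's decomposition, by name: `flatNg j = −gaugeDev j + massDev j`. [folklore] -/
theorem flatNg_eq_neg_gaugeDev_add_massDev (j : ℕ) :
    flatNg d k N L j = -gaugeDev d k N L j + massDev d k N L j :=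
  flatNg_eq d k N L j

/-- **SIZE**: `|massDev j (z,w)| ≤ (L^{min(j,k)})^{−(d+3)} + (L^j)^{−(d+3)}` at EVERY level — the `Q*Q` entries are
`≤ n^{−(d+1)}` (`norm_QvAdj_QvOp_le`) times `η_j² = n^{−2}`; the mass model has entries `≤ 1/(L^j)^{d+3}`
(`abs_massKernel_le`, `|τ| ≤ 1` by `abs_tau_le_one` for the isometric flat transport). [folklore] -/
theorem abs_massDev_le (j : ℕ) (z w : TPt (d + 1) (N * L ^ k) × Fin (d + 1)) :
    |massDev d k N L j z w| ≤ ((side k L j : ℝ) ^ (d + 3))⁻¹ + (((L : ℝ) ^ j) ^ (d + 3))⁻¹ := by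
  set n := side k L j with hn
  have hn1 : 1 ≤ n := one_le_side k L j
  have hnpos : (0 : ℝ) < (n : ℝ) := by exact_mod_cast hn1
  have hLpos : (0 : ℝ) < (L : ℝ) := by exact_mod_cast Nat.pos_of_ne_zero (NeZero.ne L)
  unfold massDev
  rw [Matrix.sub_apply, Matrix.smul_apply, RI_apply, smul_eq_mul]
  refine (abs_sub _ _).trans (add_le_add ?_ ?_)
  · rw [abs_mul, abs_of_nonneg (by positivity)]
    have hre : |reM (QvAdj n (Mlev d k N L j) * QvOp n (Mlev d k N L j)) (eF d k N L j z.1, z.2) (eF d k N L j w.1, w.2)|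
        ≤ 1 / (n : ℝ) ^ (d + 1) :=
      (Complex.abs_re_le_norm _).trans (norm_QvAdj_QvOp_le n (Mlev d k N L j) _ _)
    calc ((n : ℝ) ^ 2)⁻¹ * |reM (QvAdj n (Mlev d k N L j) * QvOp n (Mlev d k N L j)) (eF d k N L j z.1, z.2)
            (eF d k N L j w.1, w.2)|
        ≤ ((n : ℝ) ^ 2)⁻¹ * (1 / (n : ℝ) ^ (d + 1)) := mul_le_mul_of_nonneg_left hre (by positivity)
      _ = ((n : ℝ) ^ (d + 3))⁻¹ := by field_simp; ring
  · have hτ := abs_tau_le_one (cubeComb (d + 1) k N L j) (flatRm d k N L) (flatRm_isometric d k N L)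
    have hm : (0 : ℝ) ≤ flatAm j / ((L : ℝ) ^ j) ^ (d + 1 + 2) := by unfold flatAm; positivity
    refine (abs_massKernel_le (cubeI (d + 1) k N L (Fin (d + 1)) j) _ hm hτ z w).trans ?_
    split_ifs
    · unfold flatAm
      rw [one_div]
    · positivity

/-- **RANGE**: a non-zero entry `massDev j (z,w)` has `cube z`, `cube w` at integer ℓ¹ block distance `≤ 1` (the mass
model is block-diagonal; `Q*_jQ_j` couples only sites of one extended block stencil — `exists_stencil_of_ne_zero`,
`nbd_le_one_of_stencil`). [folklore] -/
theorem nbd_le_one_of_massDev_ne_zero (j : ℕ) (z w : TPt (d + 1) (N * L ^ k) × Fin (d + 1))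
    (h : massDev d k N L j z w ≠ 0) :
    nbd (d + 1) k N L j (cubeI (d + 1) k N L (Fin (d + 1)) j z) (cubeI (d + 1) k N L (Fin (d + 1)) j w) ≤ 1 := by
  by_cases hc : cubeI (d + 1) k N L (Fin (d + 1)) j z = cubeI (d + 1) k N L (Fin (d + 1)) j w
  · rw [hc]; unfold nbd; rw [sub_self]; simp [npl1]
  · -- off the block diagonal the mass model vanishes, so the `Q*Q` entry is non-zero
    have hQ : (QvAdj (side k L j) (Mlev d k N L j) * QvOp (side k L j) (Mlev d k N L j))
        (eF d k N L j z.1, z.2) (eF d k N L j w.1, w.2) ≠ 0 := by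
      intro h0
      apply h
      unfold massDev
      rw [Matrix.sub_apply, Matrix.smul_apply, RI_apply, massKernel, if_neg hc, sub_zero, smul_eq_mul]
      have : reM (QvAdj (side k L j) (Mlev d k N L j) * QvOp (side k L j) (Mlev d k N L j))
          (eF d k N L j z.1, z.2) (eF d k N L j w.1, w.2) = 0 := by
        show ((QvAdj (side k L j) (Mlev d k N L j) * QvOp (side k L j) (Mlev d k N L j))
          (eF d k N L j z.1, z.2) (eF d k N L j w.1, w.2)).re = 0
        rw [h0, Complex.zero_re]
      rw [this, mul_zero]
    obtain ⟨b, r, t, r', t', hz, hw⟩ := exists_stencil_of_ne_zero (side k L j) (Mlev d k N L j) _ _ hQ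
    have hz1 : eF d k N L j z.1 = bpt (side k L j) (Mlev d k N L j) b.1 r
        + tstep (fine (side k L j) (Mlev d k N L j)) b.2 t := congrArg Prod.fst hz
    have hw1 : eF d k N L j w.1 = bpt (side k L j) (Mlev d k N L j) b.1 r'
        + tstep (fine (side k L j) (Mlev d k N L j)) b.2 t' := congrArg Prod.fst hw
    rw [cubeI_apply, cubeI_apply]
    exact nbd_le_one_of_stencil d k N L j z.1 w.1 b.1 b.2 r r' t t' hz1 hw1

omit [NeZero N] [NeZero L] in
/-- At the levels `j ≤ k` of the one type, the block side is `L^j`. [folklore] -/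
theorem side_eq_pow {j : ℕ} (hj : j ≤ k) : side k L j = L ^ j := by
  unfold side; rw [min_eq_left hj]

/-- `pref4inv t 3 = t⁻²` (the `DPD*` slot of (3.49)). [folklore] -/
theorem pref4inv_three (t : ℝ) : B9.pref4inv t 3 = t⁻¹ ^ 2 := rfl

/-- **THE (3.49)-TYPE ENTRY BOUND FOR THE MASS-DEVIATION TERM, LEVEL-FREE CONSTANTS — PROVED.**  For `j ≤ k`, every
`δ ≥ 0` and all entries: `|massDev j (z,w)| ≤ (2e^{δ/2}) · pref4inv(L^j)₃ · (L^j)^{−(d+1)} · e^{−(δ/2)·nbd_j(cube z, cube w)}`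
— exactly the hypothesis shape of `SliceTorusBlockModel.ineq349_fineKernelOf_of_entryBounds` ∕
`SliceTorusTower.stmt349Printed_torus_of_entryBounds` at the item `n = 3` with the block distance as site distance, the
constant `2e^{δ/2}` and ANY rate `δ` (the term has range one block).  The gauge half `gaugeDev` of `flatNg` is NOT
covered. [folklore] -/
theorem abs_massDev_le_349 {j : ℕ} (hj : j ≤ k) {δ : ℝ} (hδ : 0 ≤ δ)
    (z w : TPt (d + 1) (N * L ^ k) × Fin (d + 1)) :
    |massDev d k N L j z w|
      ≤ (2 * Real.exp (δ / 2)) * B9.pref4inv ((L : ℝ) ^ j) 3 * ((L : ℝ) ^ j) ^ (-((d + 1 : ℕ) : ℝ))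
        * Real.exp (-(δ / 2 * (nbd (d + 1) k N L j (cubeI (d + 1) k N L (Fin (d + 1)) j z)
            (cubeI (d + 1) k N L (Fin (d + 1)) j w) : ℝ))) := by
  have hLpos : (0 : ℝ) < (L : ℝ) := by exact_mod_cast Nat.pos_of_ne_zero (NeZero.ne L)
  have hLj : (0 : ℝ) < (L : ℝ) ^ j := pow_pos hLpos j
  set D := (nbd (d + 1) k N L j (cubeI (d + 1) k N L (Fin (d + 1)) j z) (cubeI (d + 1) k N L (Fin (d + 1)) j w) : ℝ)
    with hD
  -- the right-hand side is `2 · (L^j)^{−(d+3)} · e^{δ/2 − (δ/2)·D}`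
  have hrhs : (2 * Real.exp (δ / 2)) * B9.pref4inv ((L : ℝ) ^ j) 3 * ((L : ℝ) ^ j) ^ (-((d + 1 : ℕ) : ℝ))
        * Real.exp (-(δ / 2 * D))
      = 2 * (((L : ℝ) ^ j) ^ (d + 3))⁻¹ * Real.exp (δ / 2 * (1 - D)) := by
    rw [pref4inv_three, Real.rpow_neg hLj.le, Real.rpow_natCast, mul_sub, mul_one, sub_eq_add_neg, Real.exp_add]
    field_simp
    ring
  rw [hrhs]
  by_cases h0 : massDev d k N L j z w = 0
  · rw [h0, abs_zero]; positivity
  · have hD1 : D ≤ 1 := by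
      rw [hD]; exact_mod_cast nbd_le_one_of_massDev_ne_zero d k N L j z w h0
    have hexp : 1 ≤ Real.exp (δ / 2 * (1 - D)) := Real.one_le_exp (by nlinarith)
    have hsize := abs_massDev_le d k N L j z w
    rw [side_eq_pow k L hj, Nat.cast_pow] at hsize
    calc |massDev d k N L j z w| ≤ (((L : ℝ) ^ j) ^ (d + 3))⁻¹ + (((L : ℝ) ^ j) ^ (d + 3))⁻¹ := hsize
      _ = 2 * (((L : ℝ) ^ j) ^ (d + 3))⁻¹ * 1 := by ring
      _ ≤ 2 * (((L : ℝ) ^ j) ^ (d + 3))⁻¹ * Real.exp (δ / 2 * (1 - D)) :=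
          mul_le_mul_of_nonneg_left hexp (by positivity)

end MassDev

end Summit.QuantumFields.BalabanUV.T4Continuum.SliceFlatMassTerm
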